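import Summits.QuantumFields.YangMills.Theorems.IR.Negative.OnsetSharpSCKillWorld
import Summits.QuantumFields.YangMills.Theorems.IR.Negative.OnsetSharpFalseOfUnpinnedUnit

/-!
# Crux `IR` (stmt-QuantumFields-19354), slot `af-pincer-Uc` sharp re-cut (28967a1bf60ad397): the two negative-lane filings on
# `stub_onsetSharpSC` COINCIDE (bridge; refuter lane B `ym-cdisprove-19354-afonset` g2)

Two seats filed the load-bearing analysis of the NT calibration `LowerBounds` and the exact kill-world of I♯_SC concurrently
(same gate minute): disprove-1 g8, `OnsetSharpFalseOfUnpinnedUnit.lean` (p535054: `OnsetSharpUKPcSCFree`, `unpinnedUnit`,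
`SubscaleFailureSC`, `subscaleFailureSC_iff_not`) and this lane, `OnsetSharpSCFalseWithoutLowerBounds.lean` (p535050:
`OnsetSharpUKPcSCWithoutLB`, `exists_slow_unit_map`) + `OnsetSharpSCKillWorld.lean` (p536252: `KSMInfSharp`,
`not_onsetSharpUKPcSC_iff_ksmInfSharp`, `ksmInfSharp_iff_maxTol`, `onsetSharpUKPcSC_iff_maxTol`).  This module records, by `Iff.rfl`,
that the twin objects are the SAME propositions, so that either vocabulary may be cited, and transports the maximal-tolerance
reduction to disprove-1's name: `subscaleFailureSC_iff_maxTol`.  (The helper `clauseI_mono` is declared, with α-equivalent type, in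
both p535054's and p535050's modules; Lean's import tolerates identical duplicate theorems, and this module co-imports both as the
standing check that it does.)

Sorry-free; axioms `propext`, `Classical.choice`, `Quot.sound`; no new definitions; nothing here asserts a Theses statement.
-/

set_option autoImplicit false

namespace Summit.QuantumFields.YangMills.Cruxes.IR.AfPincerUc.SharpOnset

/-- The two «I♯_SC minus `LowerBounds`» twins are the same proposition (definitionally). -/
theorem onsetSharpUKPcSCWithoutLB_iff_free : OnsetSharpUKPcSCWithoutLB ↔ OnsetSharpUKPcSCFree := Iff.rfl

/-- The two kill-worlds of `stub_onsetSharpSC` are the same proposition (definitionally: `NoEarlyOnsetAt` inlined). -/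
theorem ksmInfSharp_iff_subscaleFailureSC : KSMInfSharp ↔ SubscaleFailureSC := Iff.rfl

/-- **disprove-1's exact kill-world is one-parametric (PROVED)**: `SubscaleFailureSC` ⟺ no early onset at `(n, maxTol n, δ_n)` for every
`n ≥ 1` at one NT-calibrated simply connected `(G, r, a)` — the supplier's freedom in `ε` buys nothing against it. -/
theorem subscaleFailureSC_iff_maxTol : SubscaleFailureSC ↔ KSMInfSharpMaxTol :=
  ksmInfSharp_iff_subscaleFailureSC.symm.trans ksmInfSharp_iff_maxTol

/-- Both refutations of the LB-deleted twin, side by side: disprove-1's concrete parasitic unit and this lane's abstract diagonal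
(`exists_slow_unit_map`) prove the same negation. -/
theorem not_onsetSharpUKPcSCFree_iff_not_withoutLB : ¬ OnsetSharpUKPcSCFree ↔ ¬ OnsetSharpUKPcSCWithoutLB := Iff.rfl

end Summit.QuantumFields.YangMills.Cruxes.IR.AfPincerUc.SharpOnset
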